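import Mathlib
import Literature.Analysis.FluidPDE.NSWave0
import HarnessLib

/-!
# Fluid-computer gadget interface (Tao's machine paradigm for true NS, typed): `GadgetSpec`, `GadgetLibrary`, `GadgetLibrary.no_global_regular_solution`

HONEST FRAMING: low prior, high value-of-information experiment on Tao's machine paradigm;
NOT a claim that NS blows up.

(Cell `pub-fluidc`, blueprint seat bp2. Companion prose: the cell packet's `SPEC-SHEET.md`, whose
§3 keys are the fields of `GadgetSpec` below, and `ASSEMBLY.md` / `Assembly.lean` of seat bp3, the
`H¹⁰`-mild twin of the theorem proved here.)

## What this file is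

Tao [cite: Tao2016AveragedNS, Thm 1.5] proved finite-time blow-up for an *averaged* Navier–Stokes
equation `∂ₜu = Δu + B̃(u,u)` by building, inside the averaged bilinear form, a self-replicating
energy pump: an infinite chain of quadratic circuits (Def 3.1, Thm 3.3, Lemma 4.1, §5, Thm 6.2,
Props 6.3–6.4) that moves almost all of the energy at frequency `(1+ε₀)ⁿ` to frequency `(1+ε₀)ⁿ⁺¹`
in time `≲ (1+ε₀)^{-5n/2}`, abruptly, with tiny leakage, and robustly enough that the next stage
fires. §1.3 of the paper suggests that the same MACHINE PARADIGM might be realisable for the true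
equations if inviscid "fluid logic gates" with good noise tolerance could be designed.

This file types the TARGET of that programme for TRUE Navier–Stokes as an interface, so that
(a) a numerical search can report a distance-to-spec against exactly these quantities
(`GadgetSpec` = the keys of the cell's `SPEC-SHEET.json`), and (b) the soft half of the argument —
a gadget library meeting the specs forces every Clay-class solution from its seed to become
unbounded before a finite horizon, so the seed has NO global smooth bounded-energy solution — is a
kernel-checked theorem (`GadgetLibrary.no_global_regular_solution`) rather than folklore; the
one-line corollary `¬ NavierStokesRegularity` (Clay (A) applied to the seed) is summit-side and
lives in `Summits/NavierStokesRegularity/NavierStokesRegularity/Theorems/` (this Literature file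
does not import problem statements). Everything hard is an explicit HYPOTHESIS FIELD of `GadgetLibrary`; nothing
in this file asserts that such a library exists, and the authors do not believe one is likely to.

## Conventions (SPEC-SHEET §1)

* Level `n` sits at WAVENUMBER `k n = k0 * s ^ n` (`s` = the scale ratio `lam` of the cell schema;
  dyadic `s = 2`, Tao `s = 1 + ε₀`). Lengths are `1 / k`. "Output class at scale `≤ λ/2`" of the
  cell brief is, in wavenumbers, the level-`(n+1)` input class at `k (n+1) = s * k n`.
* Transfer-time law `T n ≤ Cplus * (k n) ^ (-alpha)`, exponent on the WAVENUMBER: `0 < alpha` iff the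
  cascade accelerates toward small scales (finite horizon, `GadgetSpec.partialTime_le_horizon`);
  `2 ≤ alpha` iff the per-level viscous loss bound does not grow with the level
  (`GadgetSpec.viscousLoss_le`); a self-similar inviscid gadget of efficiency `eta` produces
  `alphaEff = 5/2 - log (1/eta) / (2 log s)`, and `2 < alphaEff ↔ s⁻¹ < eta`
  (`GadgetSpec.two_lt_alphaEff_iff`) — the one hard number of the spec sheet.
* `eta` efficiency, `leak` forward leakage, `dStar` viscous-loss allowance, `amp` noise amplification,
  `radius` robustness radius are RELATIVE to the level's own energy; the noise recursion of one step
  is `eta * x' ≤ amp * x + leak + dStar` and closes on `[0, radius]` iff `GadgetSpec.Closure` holds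
  (SPEC-SHEET §2 (C): "how close to 1 must `eta` be, as a function of the leakage").

## What the averaged construction gets for free and true NS must EARN (the hypothesis fields)

* F1 `GadgetLibrary.step` (realisation with robustness): for the averaged equation the cascade
  operator maps the span of the designed wavelet modes to itself and never excites undesigned ones
  (Lemma 4.1 (v) and the frequency localisation of Def 3.1), so leakage is structurally zero, the
  PDE restricted to the cascade IS the designed ODE, and robustness of the designed circuit is a
  theorem (Prop 6.3 (viii), Prop 6.4). For true NS the corresponding statement — every smooth
  bounded-energy solution passing within `radius` of the level-`n` templates is, `T n` later, within
  the affine noise budget of the level-`(n+1)` templates, having moved at least the fraction `eta` of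
  the level energy — is the open physical claim the cell's numerics measure a distance to.
* F2 designable couplings: Tao chooses the coupling table (Thm 3.2, §6.1); NS has one bilinear form.
* F3 exact discrete self-similarity (Def 3.1: level `n` is a rescaling of one circuit); here only
  UNIFORM SPECS `σ` across all levels are asked, the templates need not be rescalings of each other.
* F4 `GadgetLibrary.floor` (concentration): Tao's modes are `L²`-normalised dilates concentrated near
  the origin, so level energy `E` at frequency `k` gives velocity `≳ k^{3/2} E^{1/2}` there for free;
  for NS, point-like (codimension-3) concentration of the transferred energy inside a fixed ball is a
  hypothesis (SPEC-SHEET §2 (D): tube- or sheet-like concentration cannot beat viscosity).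
* F5 `GadgetLibrary.seed_*`: a Clay-admissible seed (smooth, divergence free, rapidly decaying)
  inside the level-0 input class with positive level energy; Tao's is one Schwartz wavelet mode.
* F6 dissipation perturbative: both settings need `alpha > 2` (equivalently `eta * s > 1` for a
  self-similar gadget) AND a large seed Reynolds number ("`n₀` sufficiently large" in Thms 4.2/6.2;
  `Re_star` of SPEC-SHEET §3); here the viscous loss is the allowance `dStar` inside `step`.
* F7 solution theory: NOT needed — `step` is quantified over every smooth bounded-energy solution and
  the contradiction is read off a LOCAL sup norm, so no uniqueness or mild-solution glue enters.

## Deliberately not here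

No construction of any gadget; no claim about any specific initial datum; no use of the averaged
equation (the in-tree `Literature.Analysis.FluidPDE.Tao2016.*` / `TaoCascade.*` files carry Tao's
theorems themselves). The numerical thresholds live in `SPEC-SHEET.md`; this file proves only the
exact inequalities they come from (`partialTime_le_horizon`, `viscousLoss_le`, `two_lt_alphaEff_iff`,
`one_lt_cube_mul_eta`) and the assembly `GadgetLibrary.no_global_regular_solution`.
-/

noncomputable section

open scoped ContDiff ENNReal Topology
open Filter Set Metric

namespace Literature.Analysis.FluidPDE.FluidComputer

/-- Physical space `ℝ³` as a Euclidean space. [folklore] -/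
abbrev E3 : Type := EuclideanSpace ℝ (Fin 3)

/-- Velocity fields on `ℝ³`; the Clay formulation works with plain functions `ℝ³ → ℝ³`. [folklore] -/
abbrev Vel : Type := E3 → E3

/-- The numerical SPECIFICATION of a uniform gadget library (the keys of the cell's `SPEC-SHEET.json`,
§3): scale ratio `s` between consecutive levels, seed wavenumber `k0`, transfer-time law
`T n ≤ Cplus * (k n) ^ (-alpha)` (wavenumber convention), efficiency `eta`, forward leakage `leak`,
viscous-loss allowance `dStar`, noise amplification `amp`, robustness radius `radius` (the last five
relative to the level energy). Abstracted from the blowup dynamics of Tao's averaged cascade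
[cite: Tao2016AveragedNS, Prop 6.3] and the programme of its §1.3. -/
structure GadgetSpec where
  /-- scale ratio between consecutive levels (`lam` in the cell schema; dyadic `= 2`) -/
  s : ℝ
  /-- seed wavenumber `k 0` -/
  k0 : ℝ
  /-- acceleration exponent of the transfer-time law `T n ≤ Cplus * (k n) ^ (-alpha)` -/
  alpha : ℝ
  /-- transfer-time constant -/
  Cplus : ℝ
  /-- efficiency: fraction of the level-`n` energy found at level `n + 1` after the step -/
  eta : ℝ
  /-- forward leakage per step, relative to the level energy -/
  leak : ℝ
  /-- viscous-loss allowance per step, relative to the level energy -/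
  dStar : ℝ
  /-- amplification factor of input noise per step -/
  amp : ℝ
  /-- robustness radius: admissible noise at the input of a gadget -/
  radius : ℝ

namespace GadgetSpec

variable (σ : GadgetSpec)

/-- Wavenumber of level `n`: `k n = k0 * s ^ n`. [folklore] -/
def k (n : ℕ) : ℝ := σ.k0 * σ.s ^ n

/-- Maximal transfer time of level `n`: `Cplus * (k n) ^ (-alpha)` (real power of the wavenumber).
[cite: Tao2016AveragedNS, Prop 6.3] (there: lifespan `≤ 10² (1+ε₀)^{-5(n-1)/2} e_{n-1}^{-1}`). -/
def Tmax (n : ℕ) : ℝ := σ.Cplus * σ.k n ^ (-σ.alpha)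

/-- The horizon `Cplus * k0 ^ (-alpha) / (1 - s ^ (-alpha))`: the sum of the geometric series of
maximal transfer times, an upper bound for every checkpoint time when `0 < alpha`
(SPEC-SHEET §2 (A)). [folklore] -/
def horizon : ℝ := σ.Cplus * σ.k0 ^ (-σ.alpha) / (1 - σ.s ^ (-σ.alpha))

/-- Sign conditions under which the specification is meaningful: `1 < s`, `0 < k0`, `0 < alpha`
(accelerating cascade), `0 ≤ Cplus`, `0 < eta`, nonnegative leakage / allowance / amplification,
`0 < radius`. [folklore] -/
structure Valid : Prop where
  one_lt_s : 1 < σ.s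
  k0_pos : 0 < σ.k0
  alpha_pos : 0 < σ.alpha
  Cplus_nonneg : 0 ≤ σ.Cplus
  eta_pos : 0 < σ.eta
  leak_nonneg : 0 ≤ σ.leak
  dStar_nonneg : 0 ≤ σ.dStar
  amp_nonneg : 0 ≤ σ.amp
  radius_pos : 0 < σ.radius

/-- CLOSURE of the affine noise recursion `eta * x' ≤ amp * x + leak + dStar` on `[0, radius]`:
`amp * radius + leak + dStar ≤ eta * radius`, i.e. `eta ≥ amp + (leak + dStar) / radius` — "how
close to 1 the efficiency must be, as a function of the leakage" (SPEC-SHEET §2 (C)). A condition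
on the spec, packaged as a one-field structure. ("Beats viscosity" is the further condition
`2 < alpha` of SPEC-SHEET §2 (B), used below as the hypothesis `2 ≤ σ.alpha` of `viscousLoss_le`;
`alpha = 2` is the critical, discretely self-similar rate.) [folklore] -/
structure Closure : Prop where
  /-- the affine noise map sends `[0, radius]` into itself -/
  le : σ.amp * σ.radius + σ.leak + σ.dStar ≤ σ.eta * σ.radius

/-- The acceleration exponent a SELF-SIMILAR inviscid gadget of efficiency `eta` produces, by
dimensional analysis with point-like concentration: `alphaEff = 5/2 - log (1/eta) / (2 log s)`
(SPEC-SHEET §2 (D)). [folklore] -/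
def alphaEff : ℝ := 5 / 2 - Real.log (1 / σ.eta) / (2 * Real.log σ.s)

variable {σ}

/-- Level wavenumbers are positive. [folklore] -/
lemma k_pos (h : σ.Valid) (n : ℕ) : 0 < σ.k n :=
  mul_pos h.k0_pos (pow_pos (zero_lt_one.trans h.one_lt_s) n)

/-- Level wavenumbers dominate the seed wavenumber. [folklore] -/
lemma k0_le_k (h : σ.Valid) (n : ℕ) : σ.k0 ≤ σ.k n :=
  le_mul_of_one_le_right h.k0_pos.le (one_le_pow₀ h.one_lt_s.le)

/-- Maximal transfer times are nonnegative. [folklore] -/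
lemma Tmax_nonneg (h : σ.Valid) (n : ℕ) : 0 ≤ σ.Tmax n :=
  mul_nonneg h.Cplus_nonneg (Real.rpow_nonneg (k_pos h n).le _)

/-- `Tmax n = Cplus * k0 ^ (-alpha) * q ^ n` with ratio `q = s ^ (-alpha)`. [folklore] -/
lemma Tmax_eq (h : σ.Valid) (n : ℕ) :
    σ.Tmax n = σ.Cplus * σ.k0 ^ (-σ.alpha) * (σ.s ^ (-σ.alpha)) ^ n := by
  unfold Tmax k
  have hs : 0 ≤ σ.s := (zero_lt_one.trans h.one_lt_s).le
  rw [Real.mul_rpow h.k0_pos.le (pow_nonneg hs n), ← Real.rpow_natCast σ.s n,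
    ← Real.rpow_mul hs, mul_comm (n : ℝ) (-σ.alpha), Real.rpow_mul hs, Real.rpow_natCast]
  ring

/-- The ratio `s ^ (-alpha)` of the transfer-time series is positive. [folklore] -/
lemma ratio_pos (h : σ.Valid) : 0 < σ.s ^ (-σ.alpha) :=
  Real.rpow_pos_of_pos (zero_lt_one.trans h.one_lt_s) _

/-- The ratio `s ^ (-alpha)` of the transfer-time series is `< 1` because `0 < alpha`, `1 < s`.
[folklore] -/
lemma ratio_lt_one (h : σ.Valid) : σ.s ^ (-σ.alpha) < 1 :=
  Real.rpow_lt_one_of_one_lt_of_neg h.one_lt_s (neg_lt_zero.2 h.alpha_pos)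

/-- SPEC-SHEET §2 (A), FINITE HORIZON: with `0 < alpha` every partial sum of maximal transfer times
is at most `horizon = Cplus * k0 ^ (-alpha) / (1 - s ^ (-alpha))`. [folklore] -/
theorem partialTime_le_horizon (h : σ.Valid) (n : ℕ) :
    ∑ m ∈ Finset.range n, σ.Tmax m ≤ σ.horizon := by
  have hq0 := ratio_pos h
  have hq1 := ratio_lt_one h
  have hA : 0 ≤ σ.Cplus * σ.k0 ^ (-σ.alpha) :=
    mul_nonneg h.Cplus_nonneg (Real.rpow_nonneg h.k0_pos.le _)
  have hgeom : ∑ m ∈ Finset.range n, (σ.s ^ (-σ.alpha)) ^ m ≤ 1 / (1 - σ.s ^ (-σ.alpha)) := by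
    rw [le_div_iff₀ (sub_pos.2 hq1), geom_sum_mul_neg]
    linarith [pow_nonneg hq0.le n]
  calc ∑ m ∈ Finset.range n, σ.Tmax m
      = σ.Cplus * σ.k0 ^ (-σ.alpha) * ∑ m ∈ Finset.range n, (σ.s ^ (-σ.alpha)) ^ m := by
        rw [Finset.mul_sum]; exact Finset.sum_congr rfl fun m _ => Tmax_eq h m
    _ ≤ σ.Cplus * σ.k0 ^ (-σ.alpha) * (1 / (1 - σ.s ^ (-σ.alpha))) :=
        mul_le_mul_of_nonneg_left hgeom hA
    _ = σ.horizon := by unfold horizon; ring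

/-- SPEC-SHEET §2 (B), VISCOSITY LEVEL-UNIFORMLY PERTURBATIVE: during step `n` the energy sits at
wavenumbers `≤ s^{3/2} k n`, so the fraction of level energy dissipated is at most
`2 ν s³ (k n)² Tmax n = 2 ν s³ Cplus (k n)^{2-alpha}`; if `2 ≤ alpha` this is bounded by its seed
value `2 ν s³ Cplus k0^{2-alpha}` for EVERY level (a condition on the seed Reynolds number alone).
[folklore] -/
theorem viscousLoss_le (h : σ.Valid) (h2 : 2 ≤ σ.alpha) {ν : ℝ} (hν : 0 ≤ ν) (n : ℕ) :
    2 * ν * σ.s ^ 3 * σ.k n ^ 2 * σ.Tmax n ≤ 2 * ν * σ.s ^ 3 * σ.Cplus * σ.k0 ^ (2 - σ.alpha) := by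
  have hk := k_pos h n
  have hkey : σ.k n ^ 2 * σ.k n ^ (-σ.alpha) = σ.k n ^ (2 - σ.alpha) := by
    rw [← Real.rpow_two, ← Real.rpow_add hk, sub_eq_add_neg]
  have hmono : σ.k n ^ (2 - σ.alpha) ≤ σ.k0 ^ (2 - σ.alpha) :=
    Real.rpow_le_rpow_of_nonpos h.k0_pos (k0_le_k h n) (by linarith)
  have hc : 0 ≤ 2 * ν * σ.s ^ 3 * σ.Cplus :=
    mul_nonneg (mul_nonneg (by positivity) (pow_nonneg (zero_lt_one.trans h.one_lt_s).le 3))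
      h.Cplus_nonneg
  calc 2 * ν * σ.s ^ 3 * σ.k n ^ 2 * σ.Tmax n
      = 2 * ν * σ.s ^ 3 * σ.Cplus * (σ.k n ^ 2 * σ.k n ^ (-σ.alpha)) := by unfold Tmax; ring
    _ = 2 * ν * σ.s ^ 3 * σ.Cplus * σ.k n ^ (2 - σ.alpha) := by rw [hkey]
    _ ≤ 2 * ν * σ.s ^ 3 * σ.Cplus * σ.k0 ^ (2 - σ.alpha) := mul_le_mul_of_nonneg_left hmono hc

/-- SPEC-SHEET §2 (D), THE EFFICIENCY THRESHOLD: `2 < alphaEff ↔ s⁻¹ < eta` (for `1 < s`,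
`0 < eta`): a self-similar gadget beats viscosity iff it transfers more than the fraction `1/s` of
its level energy per step (dyadic: more than half). [folklore] -/
theorem two_lt_alphaEff_iff (hs : 1 < σ.s) (heta : 0 < σ.eta) :
    2 < σ.alphaEff ↔ σ.s⁻¹ < σ.eta := by
  have hs0 : 0 < σ.s := zero_lt_one.trans hs
  have hlog : 0 < Real.log σ.s := Real.log_pos hs
  have h1 : Real.log (1 / σ.eta) < Real.log σ.s ↔ σ.s⁻¹ < σ.eta := by
    rw [Real.log_lt_log_iff (one_div_pos.2 heta) hs0, one_div_lt heta hs0, one_div]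
  rw [← h1]
  unfold alphaEff
  constructor
  · intro h
    have h2 : Real.log (1 / σ.eta) / (2 * Real.log σ.s) < 1 / 2 := by linarith
    rw [div_lt_iff₀ (by positivity)] at h2
    linarith
  · intro h
    have h2 : Real.log (1 / σ.eta) / (2 * Real.log σ.s) < 1 / 2 := by
      rw [div_lt_iff₀ (by positivity)]; linarith
    linarith

/-- SPEC-SHEET §2 (E): `s⁻¹ < eta` with `1 < s` gives `1 < s ^ 3 * eta`, the growth factor per
level of `(k n)³ · (level energy)`, i.e. of the squared local velocity floor. [folklore] -/
lemma one_lt_cube_mul_eta (hs : 1 < σ.s) (heta : 0 < σ.eta) (h : σ.s⁻¹ < σ.eta) :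
    1 < σ.s ^ 3 * σ.eta := by
  have hs0 : 0 < σ.s := zero_lt_one.trans hs
  have h1 : 1 < σ.s * σ.eta := by
    have := mul_lt_mul_of_pos_left h hs0
    rwa [mul_inv_cancel₀ hs0.ne'] at this
  calc (1 : ℝ) < σ.s * σ.eta := h1
    _ ≤ σ.s ^ 3 * σ.eta :=
        mul_le_mul_of_nonneg_right (le_self_pow₀ hs.le (by norm_num)) heta.le

end GadgetSpec

/-- A GADGET LIBRARY for the true Navier–Stokes equations with viscosity `ν`, meeting the uniform
specification `σ` at every level `n ≥ 0` ("a family over all dyadic scales with uniform specs").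
Data: the designed level-`n` states `template n` (documentation of intent; the classes below are
what the theorem uses), a noise functional `noise n` (distance of a velocity field to the level-`n`
templates, relative to the level energy: the INPUT CLASS of gadget `n` is `{v | noise n v ≤ σ.radius}`),
a level-energy functional `levelEnergy n`, actual transfer times `T n ≤ σ.Tmax n`, a Clay-admissible
`seed` in the level-0 input class with level energy `≥ E0 > 0`, and the two PHYSICAL HYPOTHESES
(module docstring, F1 and F4):
* `step` — for EVERY smooth bounded-energy solution `(u, p)` of NS from any datum and every time
  `t ≥ 0` at which `u t` is in the level-`n` input class, at time `t + T n` the affine noise budget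
  `eta * noise (n+1) ≤ amp * noise n + leak + dStar` holds and at least the fraction `eta` of the
  level-`n` energy is level-`(n+1)` energy (efficiency; leakage and viscous loss are inside the budget);
* `floor` — a field in the level-`n` input class has, somewhere in the fixed ball of radius `R`, squared
  speed at least `cFloor * (k n)³ * levelEnergy n` (point-like concentration of the level energy).
Nothing asserts such a library exists. Abstracted from [cite: Tao2016AveragedNS, Prop 6.3]
(blowup dynamics (vii)–(ix)) and Prop 6.4 (the induction closing them), where the analogous
properties are THEOREMS about the averaged equation. -/
structure GadgetLibrary (ν : ℝ) (σ : GadgetSpec) where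
  /-- designed level-`n` states (templates); documentation of intent -/
  template : ℕ → Set Vel
  /-- noise functional of level `n`, relative to the level energy -/
  noise : ℕ → Vel → ℝ
  /-- energy carried at level `n` (near the nest), an absolute quantity -/
  levelEnergy : ℕ → Vel → ℝ
  /-- actual transfer time of level `n` -/
  T : ℕ → ℝ
  /-- transfer times are nonnegative -/
  T_nonneg : ∀ n, 0 ≤ T n
  /-- transfer times obey the law `T n ≤ Cplus * (k n) ^ (-alpha)` -/
  T_le_Tmax : ∀ n, T n ≤ σ.Tmax n
  /-- the seed datum -/
  seed : Vel
  /-- the seed is smooth (Clay (A) hypothesis) -/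
  seed_smooth : ContDiff ℝ ∞ seed
  /-- the seed is divergence free (Clay (A) hypothesis) -/
  seed_divFree : NSWave0.IsDivFree seed
  /-- the seed and all its derivatives decay faster than any polynomial (Clay (A), eq. (4)) -/
  seed_decay : HasRapidSpatialDecay seed
  /-- the seed lies in the level-0 input class -/
  seed_noise : noise 0 seed ≤ σ.radius
  /-- a positive lower bound for the seed's level-0 energy -/
  E0 : ℝ
  /-- positivity of `E0` -/
  E0_pos : 0 < E0
  /-- the seed carries level-0 energy at least `E0` -/
  seed_energy : E0 ≤ levelEnergy 0 seed
  /-- F1, THE STEP HYPOTHESIS (realisation + robustness + efficiency, with leakage and viscous loss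
  inside the affine budget), for every Clay-class solution and every entry time `t ≥ 0` -/
  step : ∀ (u₀ : Vel) (u : ℝ → Vel) (p : ℝ → E3 → ℝ),
    IsSmoothOnHalfSpace u → IsSmoothOnHalfSpace p → IsNavierStokesSolution ν 0 u₀ u p →
    HasBoundedEnergy u → ∀ (n : ℕ) (t : ℝ), 0 ≤ t → noise n (u t) ≤ σ.radius →
      σ.eta * noise (n + 1) (u (t + T n)) ≤ σ.amp * noise n (u t) + σ.leak + σ.dStar ∧
        σ.eta * levelEnergy n (u t) ≤ levelEnergy (n + 1) (u (t + T n))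
  /-- radius of the fixed ball containing the nest of all levels -/
  R : ℝ
  /-- concentration constant -/
  cFloor : ℝ
  /-- positivity of the concentration constant -/
  cFloor_pos : 0 < cFloor
  /-- F4, THE CONCENTRATION FLOOR: level-`n` energy `E` in the input class forces squared speed
  `≥ cFloor * (k n)³ * E` somewhere in the ball of radius `R` -/
  floor : ∀ (n : ℕ) (v : Vel), noise n v ≤ σ.radius →
    ∃ x : E3, ‖x‖ ≤ R ∧ cFloor * σ.k n ^ 3 * levelEnergy n v ≤ ‖v x‖ ^ 2

namespace GadgetLibrary

variable {ν : ℝ} {σ : GadgetSpec} (lib : GadgetLibrary ν σ)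

/-- The INPUT CLASS of gadget `n`: fields within `radius` of the level-`n` templates in the noise
functional. [folklore] -/
def inputClass (n : ℕ) : Set Vel := {v | lib.noise n v ≤ σ.radius}

/-- The seed is in the level-0 input class. [folklore] -/
lemma seed_mem_inputClass : lib.seed ∈ lib.inputClass 0 := lib.seed_noise

/-- Checkpoint time of level `n`: `Σ_{m<n} T m`, the time at which the cascade started from the seed
at time 0 enters level `n`. [folklore] -/
def checkpoint (n : ℕ) : ℝ := ∑ m ∈ Finset.range n, lib.T m

/-- The level-0 checkpoint is time 0. [folklore] -/
@[simp] lemma checkpoint_zero : lib.checkpoint 0 = 0 := by simp [checkpoint]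

/-- Checkpoints advance by the transfer times. [folklore] -/
lemma checkpoint_succ (n : ℕ) : lib.checkpoint (n + 1) = lib.checkpoint n + lib.T n := by
  simp [checkpoint, Finset.sum_range_succ]

/-- Checkpoints are nonnegative times. [folklore] -/
lemma checkpoint_nonneg (n : ℕ) : 0 ≤ lib.checkpoint n :=
  Finset.sum_nonneg fun m _ => lib.T_nonneg m

/-- Every checkpoint happens before the horizon (SPEC-SHEET §2 (A)). [folklore] -/
lemma checkpoint_le_horizon (hσ : σ.Valid) (n : ℕ) : lib.checkpoint n ≤ σ.horizon :=
  (Finset.sum_le_sum fun m _ => lib.T_le_Tmax m).trans (GadgetSpec.partialTime_le_horizon hσ n)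

/-- THE CASCADE INVARIANT: along any Clay-class solution from the seed, at the `n`-th checkpoint the
solution is in the level-`n` input class and carries level-`n` energy at least `E0 * eta ^ n`
(closure of the noise recursion, SPEC-SHEET §2 (C), by induction on the level). [folklore] -/
theorem invariant (hσ : σ.Valid) (hclos : σ.Closure) {u : ℝ → Vel} {p : ℝ → E3 → ℝ}
    (hu : IsSmoothOnHalfSpace u) (hp : IsSmoothOnHalfSpace p)
    (hsol : IsNavierStokesSolution ν 0 lib.seed u p) (hE : HasBoundedEnergy u) (n : ℕ) :
    lib.noise n (u (lib.checkpoint n)) ≤ σ.radius ∧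
      lib.E0 * σ.eta ^ n ≤ lib.levelEnergy n (u (lib.checkpoint n)) := by
  induction n with
  | zero =>
    rw [checkpoint_zero, hsol.initial]
    exact ⟨lib.seed_noise, by simpa using lib.seed_energy⟩
  | succ n ih =>
    obtain ⟨hx, hEn⟩ := ih
    obtain ⟨hnoise, henergy⟩ :=
      lib.step lib.seed u p hu hp hsol hE n (lib.checkpoint n) (lib.checkpoint_nonneg n) hx
    rw [checkpoint_succ]
    refine ⟨?_, ?_⟩
    · have h1 : σ.eta * lib.noise (n + 1) (u (lib.checkpoint n + lib.T n)) ≤ σ.eta * σ.radius :=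
        calc σ.eta * lib.noise (n + 1) (u (lib.checkpoint n + lib.T n))
            ≤ σ.amp * lib.noise n (u (lib.checkpoint n)) + σ.leak + σ.dStar := hnoise
          _ ≤ σ.amp * σ.radius + σ.leak + σ.dStar := by
              have := mul_le_mul_of_nonneg_left hx hσ.amp_nonneg
              linarith
          _ ≤ σ.eta * σ.radius := hclos.le
      exact le_of_mul_le_mul_left h1 hσ.eta_pos
    · calc lib.E0 * σ.eta ^ (n + 1) = σ.eta * (lib.E0 * σ.eta ^ n) := by ring
        _ ≤ σ.eta * lib.levelEnergy n (u (lib.checkpoint n)) :=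
            mul_le_mul_of_nonneg_left hEn hσ.eta_pos.le
        _ ≤ lib.levelEnergy (n + 1) (u (lib.checkpoint n + lib.T n)) := henergy

end GadgetLibrary

/-- **The machine-paradigm assembly for TRUE Navier–Stokes.** A gadget library with valid,
closing specs (`σ.Valid`, `σ.Closure`) above the efficiency threshold `s⁻¹ < eta`
(SPEC-SHEET §2 (D)) admits NO global smooth bounded-energy solution from its seed: there are no
`u, p`, smooth on `[0,∞) × ℝ³`, solving Navier–Stokes with viscosity `ν`, zero force and datum
`lib.seed`, with bounded energy. (Clay (A) asserts exactly such a solution for every smooth,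
divergence-free, rapidly decaying datum, which the seed is — so summit-side this is
`¬ NavierStokesRegularity`; that corollary is not stated here because Literature files do not
import problem statements.)
Proof: along such a solution `GadgetLibrary.invariant` passes every checkpoint, all before
`σ.horizon`; the concentration floor gives points `xₙ` in the ball of radius `R` with
`‖u (tₙ) xₙ‖² ≥ cFloor * k0³ * E0 * (s³ eta)ⁿ → ∞` (`GadgetSpec.one_lt_cube_mul_eta`), contradicting
boundedness of the smooth `u` on the compact cylinder `[0, horizon] × B̄(0, R)`.
The hypotheses `step` and `floor` are exactly what the averaged equation provides for free
[cite: Tao2016AveragedNS, Prop 6.3] and true NS does not (module docstring, F1–F7).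
HONEST FRAMING: an implication from an interface nobody has instantiated; NOT a claim that NS
blows up. -/
theorem GadgetLibrary.no_global_regular_solution {ν : ℝ} {σ : GadgetSpec} (hσ : σ.Valid)
    (hclos : σ.Closure) (hvisc : σ.s⁻¹ < σ.eta) (lib : GadgetLibrary ν σ) :
    ¬ ∃ (u : ℝ → Vel) (p : ℝ → E3 → ℝ), IsSmoothOnHalfSpace u ∧ IsSmoothOnHalfSpace p ∧
        IsNavierStokesSolution ν 0 lib.seed u p ∧ HasBoundedEnergy u := by
  rintro ⟨u, p, hu, hp, hsol, hE⟩
  -- smoothness on the closed half-space gives a uniform bound on the compact cylinder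
  have hu' : ContDiffOn ℝ ∞ (Function.uncurry u) (Set.Ici (0 : ℝ) ×ˢ Set.univ) := hu
  obtain ⟨C, hC⟩ :=
    (isCompact_Icc.prod (isCompact_closedBall (0 : E3) lib.R)).exists_bound_of_continuousOn
      (hu'.continuousOn.mono (Set.prod_mono Set.Icc_subset_Ici_self (Set.subset_univ _)))
  -- along the cascade the squared speed floor is therefore bounded by `(max C 1)²`
  have bound : ∀ n, lib.cFloor * σ.k n ^ 3 * (lib.E0 * σ.eta ^ n) ≤ max C 1 ^ 2 := by
    intro n
    obtain ⟨hx, hEn⟩ := lib.invariant hσ hclos hu hp hsol hE n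
    obtain ⟨x, hxR, hfloor⟩ := lib.floor n (u (lib.checkpoint n)) hx
    have hmem : (lib.checkpoint n, x) ∈ Set.Icc (0 : ℝ) σ.horizon ×ˢ Metric.closedBall (0 : E3) lib.R :=
      ⟨⟨lib.checkpoint_nonneg n, lib.checkpoint_le_horizon hσ n⟩, mem_closedBall_zero_iff.2 hxR⟩
    have hux : ‖u (lib.checkpoint n) x‖ ≤ max C 1 := (hC _ hmem).trans (le_max_left _ _)
    have hk3 : 0 ≤ lib.cFloor * σ.k n ^ 3 :=
      mul_nonneg lib.cFloor_pos.le (pow_nonneg (GadgetSpec.k_pos hσ n).le 3)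
    calc lib.cFloor * σ.k n ^ 3 * (lib.E0 * σ.eta ^ n)
        ≤ lib.cFloor * σ.k n ^ 3 * lib.levelEnergy n (u (lib.checkpoint n)) :=
          mul_le_mul_of_nonneg_left hEn hk3
      _ ≤ ‖u (lib.checkpoint n) x‖ ^ 2 := hfloor
      _ ≤ max C 1 ^ 2 := pow_le_pow_left₀ (norm_nonneg _) hux 2
  -- but that floor is `cFloor * k0³ * E0 * (s³ * eta) ^ n → ∞`
  have hq : 1 < σ.s ^ 3 * σ.eta := GadgetSpec.one_lt_cube_mul_eta hσ.one_lt_s hσ.eta_pos hvisc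
  have hA : 0 < lib.cFloor * σ.k0 ^ 3 * lib.E0 :=
    mul_pos (mul_pos lib.cFloor_pos (pow_pos hσ.k0_pos 3)) lib.E0_pos
  have htend : Tendsto (fun n : ℕ => lib.cFloor * σ.k0 ^ 3 * lib.E0 * (σ.s ^ 3 * σ.eta) ^ n)
      atTop atTop :=
    (tendsto_pow_atTop_atTop_of_one_lt hq).const_mul_atTop hA
  obtain ⟨n, hn⟩ := (htend.eventually_gt_atTop (max C 1 ^ 2)).exists
  have heq : lib.cFloor * σ.k0 ^ 3 * lib.E0 * (σ.s ^ 3 * σ.eta) ^ n =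
      lib.cFloor * σ.k n ^ 3 * (lib.E0 * σ.eta ^ n) := by
    unfold GadgetSpec.k; ring
  have hn' : max C 1 ^ 2 < lib.cFloor * σ.k n ^ 3 * (lib.E0 * σ.eta ^ n) := by
    rw [← heq]; exact hn
  exact absurd (bound n) (not_le.2 hn')

/-- The same conclusion with the threshold phrased through the exponent: a valid, closing library
whose self-similar exponent beats viscosity (`2 < alphaEff`, SPEC-SHEET §2 (D)) admits no global
smooth bounded-energy solution from its seed. [folklore] -/
theorem GadgetLibrary.no_global_regular_solution_of_alphaEff {ν : ℝ} {σ : GadgetSpec}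
    (hσ : σ.Valid) (hclos : σ.Closure) (hα : 2 < σ.alphaEff) (lib : GadgetLibrary ν σ) :
    ¬ ∃ (u : ℝ → Vel) (p : ℝ → E3 → ℝ), IsSmoothOnHalfSpace u ∧ IsSmoothOnHalfSpace p ∧
        IsNavierStokesSolution ν 0 lib.seed u p ∧ HasBoundedEnergy u :=
  lib.no_global_regular_solution hσ hclos
    ((GadgetSpec.two_lt_alphaEff_iff hσ.one_lt_s hσ.eta_pos).1 hα)

end Literature.Analysis.FluidPDE.FluidComputer

end
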